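import Summits.CriticalPhenomena.PercolationContinuityZ3.Theorems.PercNearOneGluingNoHeavyRsw3NarrowHardCrossingCritical
import Summits.CriticalPhenomena.PercolationContinuityZ3.Theorems.PercNearOneGluingNoHeavyRsw3HardCrossingDoubling
import Summits.CriticalPhenomena.PercolationContinuityZ3.Theorems.PercAnnulusCrossingHardSubmult
import Mathlib.Analysis.Subadditive
import HarnessLib

/-!
# RSW3 lane (P2, gen 7): the HARD-CROSSING RATE `γ_p(N)` — hard crossings of the tube of width `N` are exponential
# in the length with a well-defined rate, two-sidedly up to `(N+1)⁴` (every `p`); 3D RSW-lower for all aspects with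
# geometric constants ⟺ `sup_N N·γ_{p_c}(N) < ∞`; the tree's floor reads `N·γ_{p_c}(N) ≤ 4 log N + C`

builds on p205010 (kernel theorem, internal audit signed; external expert review pending)

Cell `prim-rsw3`, prover seat `prim-rsw3-p2` (gen 7), memo `run/shared/lean/prim/rsw3/P2-RSWLITE.md` §13.
Support file (`--supports stmt-CriticalPhenomena-4575`); no definitions, no named facts, no sorries.

`H_p(ℓ, N) = P_p(boxCross ![ℓ, N, N] 0)` (the block `{0..ℓ} × {0..N}²` crossed lengthwise).  BK SUBmultiplicativity
`H(a+b+1) ≤ H(a) H(b)` (`Crossing.real_boxCross_long_le_mul`, p218937) and doubling SUPERmultiplicativity `H(2ℓ) ≥ H(ℓ)²/(N+1)⁴`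
(`Rsw3.sq_real_boxCross_le_card_sq_mul_real_boxCross_double`, p223293), both at EVERY `p`, with Fekete's lemma (Mathlib
`Subadditive`) on `ℓ ↦ log H(ℓ-1)` give (`exists_hardCrossingRate`): for every `p > 0` and `N` there is `γ = γ_p(N) ≥ 0` with
  `-log H_p(ℓ, N)/ℓ → γ`,   `e^{-γ(ℓ+1)} ≤ H_p(ℓ, N)`  (all `ℓ`),   `H_p(ℓ, N) ≤ (N+1)⁴ e^{-γ ℓ}`  (`ℓ ≥ 1`)
— EXPONENTIAL in the length with a well-defined rate, two-sidedly up to the polynomial prefactor `(N+1)⁴` (lower envelope: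
submultiplicativity; upper envelope: doubling).  At `p_c(ℤ³)`:
* `hardCrossingRate_criticalProbI_le`: `N γ_{p_c}(N) ≤ 4 log N + C` (`N ≥ 1`; the gen-7 floor `H_a(N) ≥ c^a/N^{4a-2}`,
  `exists_le_real_boxCross_hardShape_geometric`); census (non-rigorous): `H_a(n) ≈ 4.4 e^{-2.74 a}`, i.e. `N γ_{p_c}(N) ≈ 2.74`;
* `geometric_hardCrossingLowerBound_iff_bddAbove_rate`: **(∃ c > 0 ∀ a, N ≥ 1: H_{p_c}(aN, N) ≥ c^{a+1}) ⟺ (∃ M ∀ N ≥ 1: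
  N γ_{p_c}(N) ≤ M)** — 3D RSW (lower half, hard direction, all aspects, geometric constants) is EQUIVALENT to "the critical
  hard-crossing rate per unit aspect is bounded in the width", a statement about the `a → ∞` TAIL only; the left side gives
  `Crossing.HardCrossingLowerBound a` for every `a ≥ 1` (`hardCrossingLowerBound_of_geometric`).
HONEST SIZE: Fekete bookkeeping on two tree inequalities; nothing uniform is proved; the value is the scalar reformulation
`X := sup_N N γ_{p_c}(N) < ∞` of (S1-lo-hard) and the two-sided envelope.

References: M. Fekete (1923) / Mathlib `Subadditive`; J. van den Berg, H. Kesten (1985); G. Grimmett, *Percolation* (1999),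
Thm. (6.44)/(6.46) (the same sandwich for the two-point function); H. Kesten (1982) §3.3. [folklore]
-/

noncomputable section

namespace Summit.CriticalPhenomena.PercolationContinuityZ3.Theorems

open MeasureTheory ProbabilityTheory Filter Topology
open Literature.Probability.Percolation Literature.Probability.LatticeModels
open Literature.Barriers.CriticalPhenomena

namespace Rsw3

open SurfaceTension Crossing

/-! ## Tubes `{0..ℓ} × {0..N}²`: positivity, the empty length, doubling -/

/-- `p^ℓ ≤ H_p(ℓ, N)`: the straight segment. [folklore] -/
theorem pow_le_real_boxCross_tube (p : unitInterval) (ℓ N : ℕ) :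
    (p : ℝ) ^ ℓ ≤ (bondPercolation (zdGraph 3) p).real (boxCross (![(ℓ : ℤ), N, N] : Site 3) 0) := by
  have hL : ∀ j : Fin 3, 0 ≤ (![(ℓ : ℤ), N, N] : Site 3) j := by
    intro j; fin_cases j <;> simp
  have h := pow_le_real_boxCross p hL 0
  have h0 : ((![(ℓ : ℤ), N, N] : Site 3) 0).toNat = ℓ := by simp
  rwa [h0] at h

/-- `H_p(0, N) = 1`: a block of length `0` is crossed by the empty path. [folklore] -/
theorem real_boxCross_tube_zero (p : unitInterval) (N : ℕ) :
    (bondPercolation (zdGraph 3) p).real (boxCross (![((0 : ℕ) : ℤ), N, N] : Site 3) 0) = 1 := by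
  have h : boxCross (![((0 : ℕ) : ℤ), N, N] : Site 3) 0 = Set.univ := by
    refine Set.eq_univ_of_forall fun ω => ?_
    have h0 : (0 : Site 3) ∈ Finset.Icc (0 : Site 3) ![((0 : ℕ) : ℤ), N, N] := by
      rw [Finset.mem_Icc]; refine ⟨le_rfl, fun j => ?_⟩; fin_cases j <;> simp
    simp only [boxCross, Set.mem_setOf_eq]
    refine ⟨0, h0, 0, h0, rfl, by simp, ?_⟩
    exact ⟨Finset.mem_coe.2 h0, Finset.mem_coe.2 h0, SimpleGraph.Reachable.refl _⟩
  rw [h, probReal_univ]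

/-- The far face of `{0..ℓ} × {0..N}²` has at most `(N+1)²` points. [folklore] -/
theorem card_face_tube_le (ℓ N : ℕ) :
    (((Finset.Icc 0 (![(ℓ : ℤ), N, N] : Site 3)).filter
        (fun x => x 0 = (![(ℓ : ℤ), N, N] : Site 3) 0)).card : ℝ) ≤ ((N : ℝ) + 1) ^ 2 := by
  classical
  set F := (Finset.Icc 0 (![(ℓ : ℤ), N, N] : Site 3)).filter (fun x => x 0 = (![(ℓ : ℤ), N, N] : Site 3) 0)
    with hF
  set T : Finset (ℤ × ℤ) := Finset.Icc (0 : ℤ) N ×ˢ Finset.Icc (0 : ℤ) N with hT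
  have hmaps : ∀ x ∈ F, (x 1, x 2) ∈ T := by
    intro x hx
    obtain ⟨hx, -⟩ := Finset.mem_filter.1 hx
    rw [Finset.mem_Icc] at hx
    have h1 := hx.1 1; have h2 := hx.2 1; have h3 := hx.1 2; have h4 := hx.2 2
    simp only [Pi.zero_apply, Matrix.cons_val_one, Matrix.cons_val_two, Matrix.head_cons,
      Matrix.tail_cons] at h1 h2 h3 h4
    rw [hT, Finset.mem_product, Finset.mem_Icc, Finset.mem_Icc]
    exact ⟨⟨h1, h2⟩, h3, h4⟩
  have hinj : Set.InjOn (fun x : Site 3 => (x 1, x 2)) ↑F := by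
    intro x hx y hy hxy
    simp only [Prod.mk.injEq] at hxy
    have hx0 := (Finset.mem_filter.1 (Finset.mem_coe.1 hx)).2
    have hy0 := (Finset.mem_filter.1 (Finset.mem_coe.1 hy)).2
    funext j
    fin_cases j
    · exact hx0.trans hy0.symm
    · exact hxy.1
    · exact hxy.2
  have hcard : F.card ≤ T.card := Finset.card_le_card_of_injOn _ hmaps hinj
  have hT_card : T.card = (N + 1) * (N + 1) := by
    rw [hT, Finset.card_product, Int.card_Icc]
    simp
  calc (F.card : ℝ) ≤ T.card := by exact_mod_cast hcard
    _ = ((N : ℝ) + 1) ^ 2 := by rw [hT_card]; push_cast; ring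

/-- **Doubling for tubes of every length** (every `p`): `H_p(ℓ, N)² ≤ (N+1)⁴ H_p(2ℓ, N)`. [folklore] -/
theorem sq_real_boxCross_tube_le (p : unitInterval) (ℓ N : ℕ) :
    (bondPercolation (zdGraph 3) p).real (boxCross (![(ℓ : ℤ), N, N] : Site 3) 0) ^ 2 ≤
      ((N : ℝ) + 1) ^ 4 * (bondPercolation (zdGraph 3) p).real (boxCross (![((2 * ℓ : ℕ) : ℤ), N, N] : Site 3) 0) := by
  have hL : (0 : Site 3) ≤ (![(ℓ : ℤ), N, N] : Site 3) := by
    intro j; fin_cases j <;> simp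
  have hdouble : (![(ℓ : ℤ), N, N] : Site 3) + Pi.single 0 ((![(ℓ : ℤ), N, N] : Site 3) 0) =
      ![((2 * ℓ : ℕ) : ℤ), N, N] := by
    funext j; fin_cases j <;> simp; ring
  have h := sq_real_boxCross_le_card_sq_mul_real_boxCross_double p hL 0
  rw [hdouble] at h
  refine h.trans (mul_le_mul_of_nonneg_right ?_ measureReal_nonneg)
  calc (((Finset.Icc 0 (![(ℓ : ℤ), N, N] : Site 3)).filter
          (fun x => x 0 = (![(ℓ : ℤ), N, N] : Site 3) 0)).card : ℝ) ^ 2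
      ≤ (((N : ℝ) + 1) ^ 2) ^ 2 := pow_le_pow_left₀ (by positivity) (card_face_tube_le ℓ N) 2
    _ = ((N : ℝ) + 1) ^ 4 := by ring

/-- **The hard-crossing rate.**  For every `p ∈ (0, 1]` and width `N` there is `γ = γ_p(N) ≥ 0` with `-log H_p(ℓ, N)/ℓ → γ`,
`e^{-γ(ℓ+1)} ≤ H_p(ℓ, N)` (all `ℓ`; Fekete on the submultiplicative `ℓ ↦ H(ℓ-1)`) and `H_p(ℓ, N) ≤ (N+1)⁴ e^{-γ ℓ}` (`ℓ ≥ 1`;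
`ℓ ↦ log(H(ℓ)/(N+1)⁴)/ℓ` is non-decreasing along doubling, `sq_real_boxCross_tube_le`). [folklore] -/
theorem exists_hardCrossingRate (p : unitInterval) (hp : 0 < (p : ℝ)) (N : ℕ) :
    ∃ γ : ℝ, 0 ≤ γ ∧
      Tendsto (fun ℓ : ℕ =>
        -Real.log ((bondPercolation (zdGraph 3) p).real (boxCross (![(ℓ : ℤ), N, N] : Site 3) 0)) / ℓ)
        atTop (𝓝 γ) ∧
      (∀ ℓ : ℕ, Real.exp (-(γ * (ℓ + 1))) ≤
        (bondPercolation (zdGraph 3) p).real (boxCross (![(ℓ : ℤ), N, N] : Site 3) 0)) ∧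
      (∀ ℓ : ℕ, 1 ≤ ℓ → (bondPercolation (zdGraph 3) p).real (boxCross (![(ℓ : ℤ), N, N] : Site 3) 0) ≤
        ((N : ℝ) + 1) ^ 4 * Real.exp (-(γ * ℓ))) := by
  set μ := bondPercolation (zdGraph 3) p with hμ
  set H : ℕ → ℝ := fun ℓ => μ.real (boxCross (![(ℓ : ℤ), N, N] : Site 3) 0) with hH
  have hHpos : ∀ ℓ, 0 < H ℓ := fun ℓ => lt_of_lt_of_le (pow_pos hp ℓ) (pow_le_real_boxCross_tube p ℓ N)
  have hHle : ∀ ℓ, H ℓ ≤ 1 := fun ℓ => measureReal_le_one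
  have hH0 : H 0 = 1 := real_boxCross_tube_zero p N
  have hsub : ∀ a b, H (a + b + 1) ≤ H a * H b := fun a b => real_boxCross_long_le_mul p N a b
  have hdbl : ∀ ℓ, H ℓ ^ 2 ≤ ((N : ℝ) + 1) ^ 4 * H (2 * ℓ) := fun ℓ => sq_real_boxCross_tube_le p ℓ N
  have hlogle : ∀ ℓ, Real.log (H ℓ) ≤ 0 := fun ℓ => Real.log_nonpos (hHpos ℓ).le (hHle ℓ)
  -- Fekete for `u n = log H(n-1)`
  set u : ℕ → ℝ := fun n => Real.log (H (n - 1)) with hu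
  have hsubadd : Subadditive u := by
    intro m n
    rcases Nat.eq_zero_or_pos m with rfl | hm
    · simp [hu, hH0]
    rcases Nat.eq_zero_or_pos n with rfl | hn
    · simp [hu, hH0]
    have heq : m + n - 1 = (m - 1) + (n - 1) + 1 := by omega
    simp only [hu]
    rw [heq, ← Real.log_mul (hHpos _).ne' (hHpos _).ne']
    exact Real.log_le_log (hHpos _) (hsub _ _)
  have hp1 : (p : ℝ) ≤ 1 := p.2.2
  have hlogp : Real.log p ≤ 0 := Real.log_nonpos hp.le hp1
  have hbdd : BddBelow (Set.range fun n => u n / n) := by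
    refine ⟨Real.log p, ?_⟩
    rintro _ ⟨n, rfl⟩
    rcases Nat.eq_zero_or_pos n with rfl | hn
    · simp [hlogp]
    have hn' : (0 : ℝ) < n := by exact_mod_cast hn
    -- `log p ≤ (n-1) log p / n ≤ log H(n-1) / n`
    have h1 : ((n - 1 : ℕ) : ℝ) * Real.log p ≤ Real.log (H (n - 1)) := by
      rw [← Real.log_pow]
      exact Real.log_le_log (pow_pos hp _) (pow_le_real_boxCross_tube p (n - 1) N)
    have h2 : Real.log p ≤ ((n - 1 : ℕ) : ℝ) * Real.log p / n := by
      rw [le_div_iff₀ hn']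
      have : ((n - 1 : ℕ) : ℝ) ≤ n := by exact_mod_cast Nat.sub_le n 1
      nlinarith
    exact h2.trans (div_le_div_of_nonneg_right h1 hn'.le)
  set γ : ℝ := -hsubadd.lim with hγ
  have htend : Tendsto (fun n => u n / n) atTop (𝓝 (-γ)) := by
    rw [hγ, neg_neg]; exact hsubadd.tendsto_lim hbdd
  -- the rate of `-log H ℓ / ℓ`
  have hrate : Tendsto (fun ℓ : ℕ => -Real.log (H ℓ) / ℓ) atTop (𝓝 γ) := by
    have h1 : Tendsto (fun ℓ : ℕ => u (ℓ + 1) / ((ℓ + 1 : ℕ) : ℝ)) atTop (𝓝 (-γ)) :=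
      htend.comp (tendsto_add_atTop_nat 1)
    have h2 : Tendsto (fun ℓ : ℕ => ((ℓ : ℝ) + 1) / ℓ) atTop (𝓝 1) := by
      have h : Tendsto (fun ℓ : ℕ => 1 + 1 / (ℓ : ℝ)) atTop (𝓝 (1 + 0)) :=
        tendsto_const_nhds.add tendsto_one_div_atTop_nhds_zero_nat
      rw [add_zero] at h
      refine h.congr' ?_
      filter_upwards [eventually_ge_atTop 1] with ℓ hℓ
      have hℓ' : (ℓ : ℝ) ≠ 0 := by exact_mod_cast (by omega : ℓ ≠ 0)
      field_simp
    have h3 := (h1.mul h2).neg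
    rw [show -(-γ * 1) = γ by ring] at h3
    refine h3.congr' ?_
    filter_upwards [eventually_ge_atTop 1] with ℓ hℓ
    have hℓ' : (ℓ : ℝ) ≠ 0 := by exact_mod_cast (by omega : ℓ ≠ 0)
    have hℓ1 : (ℓ : ℝ) + 1 ≠ 0 := by positivity
    simp only [hu, Nat.add_sub_cancel]
    push_cast
    field_simp
  -- `γ ≥ 0`
  have hγ0 : 0 ≤ γ := by
    have h : -γ ≤ 0 := le_of_tendsto' htend fun n => by
      rcases Nat.eq_zero_or_pos n with rfl | hn
      · simp
      · exact div_nonpos_iff.2 (Or.inr ⟨hlogle _, by positivity⟩)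
    linarith
  refine ⟨γ, hγ0, hrate, fun ℓ => ?_, fun ℓ hℓ => ?_⟩
  · -- lower envelope: `u (ℓ+1)/(ℓ+1) ≥ -γ`
    have h := hsubadd.lim_le_div hbdd (n := ℓ + 1) (by omega)
    rw [← neg_neg (Subadditive.lim hsubadd), ← hγ] at h
    simp only [hu, Nat.add_sub_cancel] at h
    have hℓ1 : (0 : ℝ) < ((ℓ + 1 : ℕ) : ℝ) := by positivity
    rw [le_div_iff₀ hℓ1] at h
    push_cast at h
    calc Real.exp (-(γ * (ℓ + 1))) ≤ Real.exp (Real.log (H ℓ)) := Real.exp_le_exp.2 (by linarith)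
      _ = H ℓ := Real.exp_log (hHpos ℓ)
  · -- upper envelope via doubling
    set c4 : ℝ := 4 * Real.log ((N : ℝ) + 1) with hc4
    have hN1 : (0 : ℝ) < (N : ℝ) + 1 := by positivity
    have hpow4 : Real.exp c4 = ((N : ℝ) + 1) ^ 4 := by
      rw [hc4, show (4 : ℝ) * Real.log ((N : ℝ) + 1) = Real.log (((N : ℝ) + 1) ^ 4) by
        rw [Real.log_pow]; norm_num, Real.exp_log (by positivity)]
    -- `Q m = (log H m - c4)/m` is non-decreasing along doubling
    have hQ : ∀ m : ℕ, 1 ≤ m → (Real.log (H m) - c4) / m ≤ (Real.log (H (2 * m)) - c4) / ((2 * m : ℕ) : ℝ) := by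
      intro m hm
      have hm' : (0 : ℝ) < m := by exact_mod_cast hm
      have hlog : 2 * Real.log (H m) - c4 ≤ Real.log (H (2 * m)) := by
        have h := hdbl m
        have h' : H m ^ 2 / ((N : ℝ) + 1) ^ 4 ≤ H (2 * m) := by
          rw [div_le_iff₀ (by positivity)]; linarith
        have hlhs : Real.log (H m ^ 2 / ((N : ℝ) + 1) ^ 4) = 2 * Real.log (H m) - c4 := by
          rw [Real.log_div (pow_pos (hHpos m) 2).ne' (pow_pos hN1 4).ne', Real.log_pow, Real.log_pow, hc4]
          push_cast; ring
        rw [← hlhs]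
        exact Real.log_le_log (div_pos (pow_pos (hHpos m) 2) (pow_pos hN1 4)) h'
      rw [div_le_div_iff₀ hm' (by positivity)]
      push_cast
      nlinarith
    have hQj : ∀ j : ℕ, (Real.log (H ℓ) - c4) / ℓ ≤ (Real.log (H (2 ^ j * ℓ)) - c4) / ((2 ^ j * ℓ : ℕ) : ℝ) := by
      intro j
      induction j with
      | zero => simp
      | succ j ih =>
        have hm : 1 ≤ 2 ^ j * ℓ := Nat.one_le_iff_ne_zero.2 (by positivity)
        have h := hQ (2 ^ j * ℓ) hm
        have heq : 2 * (2 ^ j * ℓ) = 2 ^ (j + 1) * ℓ := by ring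
        rw [heq] at h
        exact ih.trans h
    -- the right-hand sides tend to `-γ`
    have hm : Tendsto (fun j : ℕ => 2 ^ j * ℓ) atTop atTop :=
      tendsto_atTop_mono (fun j => Nat.le_mul_of_pos_right _ (by omega))
        (tendsto_pow_atTop_atTop_of_one_lt one_lt_two)
    have hlim : Tendsto (fun j : ℕ => (Real.log (H (2 ^ j * ℓ)) - c4) / ((2 ^ j * ℓ : ℕ) : ℝ)) atTop (𝓝 (-γ)) := by
      have h1 : Tendsto (fun m : ℕ => -(-Real.log (H m) / m) - c4 / m) atTop (𝓝 (-γ - 0)) :=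
        hrate.neg.sub (tendsto_const_nhds.div_atTop tendsto_natCast_atTop_atTop)
      rw [sub_zero] at h1
      refine (h1.comp hm).congr' ?_
      filter_upwards [eventually_ge_atTop 0] with j _
      simp only [Function.comp_apply]
      ring
    have hle : (Real.log (H ℓ) - c4) / ℓ ≤ -γ := ge_of_tendsto' hlim hQj
    have hℓ' : (0 : ℝ) < ℓ := by exact_mod_cast hℓ
    rw [div_le_iff₀ hℓ'] at hle
    calc H ℓ = Real.exp (Real.log (H ℓ)) := (Real.exp_log (hHpos ℓ)).symm
      _ ≤ Real.exp (c4 + -(γ * ℓ)) := Real.exp_le_exp.2 (by linarith)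
      _ = ((N : ℝ) + 1) ^ 4 * Real.exp (-(γ * ℓ)) := by rw [Real.exp_add, hpow4]

/-- **At `p_c(ℤ³)` the hard-crossing rate is at most logarithmic in the width**: there is `C` such that for every
`N ≥ 1` the rate `γ = γ_{p_c}(N)` of `exists_hardCrossingRate` (characterised by the limit) satisfies
`N γ ≤ 4 log N + C` — from the floor `H_{p_c}(aN, N) ≥ c^a / N^{4a-2}` (`exists_le_real_boxCross_hardShape_geometric`).
Census (non-rigorous): `N γ_{p_c}(N) ≈ 2.74`, flat. [folklore] -/
theorem hardCrossingRate_criticalProbI_le :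
    ∃ C : ℝ, ∀ N : ℕ, 1 ≤ N → ∀ γ : ℝ,
      Tendsto (fun ℓ : ℕ =>
        -Real.log ((bondPercolation (zdGraph 3) (criticalProbI 3)).real
          (boxCross (![(ℓ : ℤ), N, N] : Site 3) 0)) / ℓ) atTop (𝓝 γ) →
      (N : ℝ) * γ ≤ 4 * Real.log N + C := by
  obtain ⟨c, hc, hfloor⟩ := exists_le_real_boxCross_hardShape_geometric
  refine ⟨-Real.log c, fun N hN γ hγ => ?_⟩
  set μ := bondPercolation (zdGraph 3) (criticalProbI 3) with hμ
  have hN0 : (0 : ℝ) < N := by exact_mod_cast hN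
  -- along the lengths `ℓ = a N`
  have hsub : Tendsto (fun a : ℕ => a * N) atTop atTop :=
    tendsto_atTop_mono (fun a => Nat.le_mul_of_pos_right _ (by omega)) tendsto_id
  have hlim := hγ.comp hsub
  -- each term is `≤ (4 log N - log c)/N`
  have hbound : ∀ a : ℕ, 1 ≤ a →
      -Real.log (μ.real (boxCross (![((a * N : ℕ) : ℤ), N, N] : Site 3) 0)) / ((a * N : ℕ) : ℝ) ≤
        (4 * Real.log N - Real.log c) / N := by
    intro a ha
    have h := hfloor a N ha hN
    have hshape : hardShape a N = ![((a * N : ℕ) : ℤ), N, N] := by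
      funext j; fin_cases j <;> simp [hardShape]
    rw [hshape] at h
    set X : ℝ := Real.log (μ.real (boxCross (![((a * N : ℕ) : ℤ), N, N] : Site 3) 0)) with hX
    have hcpos : (0 : ℝ) < c ^ a / (N : ℝ) ^ (4 * a - 2) := by positivity
    have hHpos : 0 < μ.real (boxCross (![((a * N : ℕ) : ℤ), N, N] : Site 3) 0) := lt_of_lt_of_le hcpos h
    have hlog : a * Real.log c - (4 * a - 2 : ℕ) * Real.log N ≤ X := by
      have h1 := Real.log_le_log hcpos h
      rwa [Real.log_div (pow_pos hc a).ne' (pow_pos hN0 _).ne', Real.log_pow, Real.log_pow] at h1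
    have haN : (0 : ℝ) < ((a * N : ℕ) : ℝ) := by positivity
    have ha0 : (0 : ℝ) ≤ a := by positivity
    rw [div_le_div_iff₀ haN hN0]
    have hlogN : 0 ≤ Real.log N := Real.log_nonneg (by exact_mod_cast hN)
    have h42 : ((4 * a - 2 : ℕ) : ℝ) ≤ 4 * a := by
      have : 4 * a - 2 ≤ 4 * a := Nat.sub_le _ _
      exact_mod_cast this
    have hkey : -X ≤ (a : ℝ) * (4 * Real.log N - Real.log c) := by
      nlinarith [mul_le_mul_of_nonneg_right h42 hlogN]
    calc -X * N ≤ ((a : ℝ) * (4 * Real.log N - Real.log c)) * N := mul_le_mul_of_nonneg_right hkey hN0.le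
      _ = (4 * Real.log N - Real.log c) * ((a * N : ℕ) : ℝ) := by push_cast; ring
  have hle : γ ≤ (4 * Real.log N - Real.log c) / N := by
    refine le_of_tendsto hlim ?_
    filter_upwards [eventually_ge_atTop 1] with a ha
    exact hbound a ha
  rw [le_div_iff₀ hN0] at hle
  linarith

/-- **3D RSW (lower half, hard direction, all aspects, geometric constants) ⟺ bounded critical hard-crossing rate**:
`⇐` by the lower envelope `H ≥ e^{-γ(ℓ+1)}`, `⇒` by the limit along `ℓ = aN`.  Both sides OPEN (numerically `N γ ≈ 2.74`);
the right side is a statement about the `a → ∞` tail only. [folklore] -/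
theorem geometric_hardCrossingLowerBound_iff_bddAbove_rate :
    (∃ c : ℝ, 0 < c ∧ ∀ a N : ℕ, 1 ≤ a → 1 ≤ N →
        c ^ (a + 1) ≤ (bondPercolation (zdGraph 3) (criticalProbI 3)).real (boxCross (hardShape a N) 0)) ↔
    (∃ M : ℝ, ∀ N : ℕ, 1 ≤ N → ∀ γ : ℝ,
        Tendsto (fun ℓ : ℕ =>
          -Real.log ((bondPercolation (zdGraph 3) (criticalProbI 3)).real
            (boxCross (![(ℓ : ℤ), N, N] : Site 3) 0)) / ℓ) atTop (𝓝 γ) →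
        (N : ℝ) * γ ≤ M) := by
  set μ := bondPercolation (zdGraph 3) (criticalProbI 3) with hμ
  have hpc0 : (0 : ℝ) < (criticalProbI 3 : unitInterval) := by
    rw [coe_criticalProbI]; exact criticalProb_zd_pos 3 (by norm_num)
  have hshape : ∀ a N : ℕ, hardShape a N = ![((a * N : ℕ) : ℤ), N, N] := by
    intro a N; funext j; fin_cases j <;> simp [hardShape]
  constructor
  · rintro ⟨c, hc, hgeo⟩
    refine ⟨-Real.log c, fun N hN γ hγ => ?_⟩
    have hN0 : (0 : ℝ) < N := by exact_mod_cast hN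
    have hsub : Tendsto (fun a : ℕ => a * N) atTop atTop :=
      tendsto_atTop_mono (fun a => Nat.le_mul_of_pos_right _ (by omega)) tendsto_id
    have hlim := hγ.comp hsub
    -- `-log H(aN)/(aN) ≤ -(a+1) log c/(aN) → -log c / N`
    have hcmp : Tendsto (fun a : ℕ => -(((a : ℝ) + 1) * Real.log c) / ((a * N : ℕ) : ℝ)) atTop
        (𝓝 (-Real.log c / N)) := by
      have h1 : Tendsto (fun a : ℕ => (1 + 1 / (a : ℝ)) * (-Real.log c / N)) atTop
          (𝓝 ((1 + 0) * (-Real.log c / N))) :=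
        (tendsto_const_nhds.add tendsto_one_div_atTop_nhds_zero_nat).mul tendsto_const_nhds
      rw [add_zero, one_mul] at h1
      refine h1.congr' ?_
      filter_upwards [eventually_ge_atTop 1] with a ha
      have ha' : (a : ℝ) ≠ 0 := by exact_mod_cast (by omega : a ≠ 0)
      push_cast
      field_simp
    have hle : γ ≤ -Real.log c / N := by
      refine le_of_tendsto_of_tendsto hlim hcmp ?_
      filter_upwards [eventually_ge_atTop 1] with a ha
      have h := hgeo a N ha hN
      rw [hshape] at h
      have hHpos : 0 < μ.real (boxCross (![((a * N : ℕ) : ℤ), N, N] : Site 3) 0) :=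
        lt_of_lt_of_le (by positivity) h
      have hlog : ((a : ℝ) + 1) * Real.log c ≤
          Real.log (μ.real (boxCross (![((a * N : ℕ) : ℤ), N, N] : Site 3) 0)) := by
        have h1 := Real.log_le_log (by positivity) h
        rw [Real.log_pow] at h1
        push_cast at h1
        exact h1
      simp only [Function.comp_apply]
      exact div_le_div_of_nonneg_right (by linarith) (by positivity)
    rw [le_div_iff₀ hN0] at hle
    linarith
  · rintro ⟨M, hM⟩
    refine ⟨Real.exp (-max M 0), Real.exp_pos _, fun a N ha hN => ?_⟩
    obtain ⟨γ, hγ0, hγ, hlow, -⟩ := exists_hardCrossingRate (criticalProbI 3) hpc0 N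
    have hNγ := hM N hN γ hγ
    have hN1 : (1 : ℝ) ≤ N := by exact_mod_cast hN
    have h := hlow (a * N)
    rw [hshape]
    refine le_trans ?_ h
    rw [← Real.exp_nat_mul]
    apply Real.exp_le_exp.2
    -- `γ (aN + 1) ≤ max M 0 · (a + 1)` since `N γ ≤ M` and `γ ≤ N γ`
    have hγN : γ ≤ (N : ℝ) * γ := by nlinarith
    have hmax : (N : ℝ) * γ ≤ max M 0 := hNγ.trans (le_max_left _ _)
    have h0 : 0 ≤ max M 0 := le_max_right _ _
    push_cast
    nlinarith

/-- The geometric form implies `Crossing.HardCrossingLowerBound a` for every `a ≥ 1` (with `c_a = c^{a+1}`). [folklore] -/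
theorem hardCrossingLowerBound_of_geometric
    (h : ∃ c : ℝ, 0 < c ∧ ∀ a N : ℕ, 1 ≤ a → 1 ≤ N →
      c ^ (a + 1) ≤ (bondPercolation (zdGraph 3) (criticalProbI 3)).real (boxCross (hardShape a N) 0))
    {a : ℕ} (ha : 1 ≤ a) : Crossing.HardCrossingLowerBound a := by
  obtain ⟨c, hc, hgeo⟩ := h
  exact ⟨c ^ (a + 1), by positivity, fun n hn => hgeo a n ha hn⟩

end Rsw3

end Summit.CriticalPhenomena.PercolationContinuityZ3.Theorems

end
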